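import Mathlib
import Summits.NavierStokesRegularity.NavierStokesRegularity.Theses.SubOnsagerCeiling
import Summits.NavierStokesRegularity.NavierStokesRegularity.Theorems.OrthantWakeOrthantInvariance
import HarnessLib

/-!
# `SubOnsagerCeiling.OrthantInvariance` — Kamke cone invariance (item
  stmt-NavierStokesRegularity-25508; shared VERBATIM with `OrthantWake.OrthantInvariance`)

**Statement.** For an orthant (quasi-positive) table `α`, every honest `ν`-viscous lattice solution
on `[0, s]` from a one-shell datum at shell `0` (vanishing below shell `0`, weighted-bounded,
continuous, solving the viscous cascade ODE within `[0, s]`) is componentwise `≥ 0` on every shell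
`k ≥ 1` throughout `[0, s]`.

PROOF. The item's text is byte-identical to route `OrthantWake`'s item `OrthantInvariance`
(stmt-NavierStokesRegularity-24642), PROVED in the tree by
`Theorems.orthantInvariance_proof` (`Theorems/OrthantWakeOrthantInvariance.lean`: Kamke's forward
invariance of the positive cone by a first-exit/Grönwall argument on the weighted negative part).
The two route decls are definitionally equal, so the tree theorem closes this item by `exact`.

HONEST FRAMING: a statement about Tao-type MODEL lattice ODEs (rung TL-M2Break); nothing here
bears on Navier–Stokes regularity and no summit is proved.
-/

noncomputable section

set_option linter.dupNamespace false

namespace Summit.NavierStokesRegularity.NavierStokesRegularity.Theorems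

/-- **Item stmt-NavierStokesRegularity-25508** (`SubOnsagerCeiling.OrthantInvariance`): Kamke cone
invariance for the viscous lattice of an orthant table — verbatim the proved
`OrthantWake.OrthantInvariance` (`Theorems.orthantInvariance_proof`). MODEL lattice statement; no
Navier–Stokes statement is proved. [this file] -/
theorem subOnsagerCeiling_orthantInvariance_proof :
    Summit.NavierStokesRegularity.NavierStokesRegularity.Theses.SubOnsagerCeiling.OrthantInvariance := by
  unfold Summit.NavierStokesRegularity.NavierStokesRegularity.Theses.SubOnsagerCeiling.OrthantInvariance
  exact orthantInvariance_proof

end Summit.NavierStokesRegularity.NavierStokesRegularity.Theorems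

end
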